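import Summits.ResolutionOfSingularities.ResolutionOfSingularities.Theorems.HomologicalConductorNoZenoSplitExcCount
import Mathlib.AlgebraicGeometry.ValuativeCriterion
import HarnessLib

/-!
# Crux `NoZenoR` (stmt-ResolutionOfSingularities-19943), slot 5 `stub_L1wCoreF3`, seam2 (m3) — (S1a) BRANCH LIFT:
# a branch of an exceptional curve at `z` is, upstairs on any proper `ρ : X¹ → X`, a branch at a point `y′` over `z`

OURS (cell res-hironaka, chain W4.4; stub worker res-L0-w44-stub-4 g8; piece (S1a) of (S1) «downstairs sep-jump» of
res-L0-w44-plan-1 RULING (ρ53e)).  Nothing here is a statement of the manuscript under review (Hironaka 2017); AI-written,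
weaker than expert review; def-free, fact-free — the valuative criteria of properness / separatedness (Mathlib) in the
branch currency of U8b (`…NoZenoSplitExcCount`: `curveGerm`, `IsBranchAt`, `toBranch`).

Setting.  `ρ : X¹ ⟶ X` a morphism of schemes, `η¹ ∈ X¹` with image `η := ρ η¹`, a specialisation `h : η ⤳ z` in `X`, and a
valuation subring `V¹` of the UPSTAIRS residue field `κ(η¹)`; along `ρ.residueFieldMap η¹ : κ(η) → κ(η¹)` it restricts to the
valuation subring `V := V¹.comap _` of `κ(η)`.  Hypothesis: `V` is a BRANCH of the curve `closure {η}` at `z`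
(`IsBranchAt z η h V`: `V ≠ ⊤` dominates the curve germ `𝒪_(E_η, z) ⊆ κ(η)`).

* `toBranchUp` bookkeeping (`exists_toValuationSubring`): the local structure map `g₀ : 𝒪_(X,z) → V¹` through the branch,
  local, with `V¹ ⊆ κ(η¹) ∘ g₀ = (𝒪_(X,z) → 𝒪_(X,η) → κ(η) → κ(η¹))`;
* **`exists_isBranchAt_lift`** — for `ρ` UNIVERSALLY CLOSED (e.g. proper): there is a point `y′ ∈ X¹` with `η¹ ⤳ y′`,
  `ρ y′ = z`, and `IsBranchAt y′ η¹ _ V¹` (the valuative criterion of properness applied to the square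
  `Spec κ(η¹) → X¹`, `Spec V¹ → Spec 𝒪_(X,z) → X`; the domination at `y′` is read off `Scheme.stalkClosedPointTo` of the lift,
  whose composite with `V¹ ⊆ κ(η¹)` is `𝒪_(X¹,y′) → 𝒪_(X¹,η¹) → κ(η¹)` because `X¹.fromSpecStalk y′` is a monomorphism);
* `eq_of_isBranchAt_of_isBranchAt` — for `ρ` SEPARATED the point `y′` is unique: two points over `z` at which `V¹` is a
  branch of `closure {η¹}` coincide (valuative criterion of separatedness);
* transport helpers `valuationSubring_comap_comap_symm` (every valuation subring of `κ(η)` is such a restriction when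
  `κ(η) ≅ κ(η¹)`) and `residueFieldMap_bijective_of_stalkMap_bijective`.

References: The Stacks Project, Tags 01KF, 01KZ (valuative criteria) [`StacksProject`]; J. Lipman, Publ. Math. IHÉS 36
(1969), §16 (16.1) p. 231 (branches of exceptional curves) [`Lipman1969`].
-/

noncomputable section

-- single-problem summit: the doubled namespace component `ResolutionOfSingularities` is forced
set_option linter.dupNamespace false

namespace Summit.ResolutionOfSingularities.ResolutionOfSingularities.Theorems.NoZeno.ExcCount

open CategoryTheory AlgebraicGeometry TopologicalSpace IsLocalRing
open Literature.AlgebraicGeometry.Resolution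

/-! ## Transport of valuation subrings along an isomorphism of residue fields -/

section Transport

/-- A valuation subring `V` of `K` is the restriction along `e : K ≃ L` of its image `V.comap e⁻¹ ⊆ L`. [folklore] -/
theorem valuationSubring_comap_comap_symm {K L : Type*} [Field K] [Field L] (V : ValuationSubring K) (e : K ≃+* L) :
    (V.comap e.symm.toRingHom).comap e.toRingHom = V := by
  ext x
  simp [ValuationSubring.mem_comap]

/-- If the stalk map of `ρ` at `x` is bijective, so is the residue field map `κ(ρ x) → κ(x)`. [folklore] -/
theorem residueFieldMap_bijective_of_stalkMap_bijective {X X1 : Scheme.{0}} (ρ : X1 ⟶ X) (x : X1)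
    (hbij : Function.Bijective (ρ.stalkMap x)) : Function.Bijective (ρ.residueFieldMap x) := by
  refine ⟨(ρ.residueFieldMap x).hom.injective, fun t => ?_⟩
  obtain ⟨s, rfl⟩ := X1.residue_surjective x t
  obtain ⟨r, rfl⟩ := hbij.2 s
  refine ⟨X.residue (ρ.base x) r, ?_⟩
  change (X.residue (ρ.base x) ≫ ρ.residueFieldMap x) r = (ρ.stalkMap x ≫ X1.residue x) r
  rw [Scheme.residue_residueFieldMap]

end Transport

/-! ## The local structure map `𝒪_(X,z) → V¹` of a branch read upstairs -/

section BranchLift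

variable {X X1 : Scheme.{0}} (ρ : X1 ⟶ X) (η1 : X1) {z : X} (h : ρ.base η1 ⤳ z)
  (V1 : ValuationSubring (X1.residueField η1))
  (hb : IsBranchAt z (ρ.base η1) h (V1.comap (ρ.residueFieldMap η1).hom))

/-- The composite `𝒪_(X,z) → 𝒪_(X,η) → κ(η) → κ(η¹)`. [folklore] -/
theorem stalkToResidueFieldUp_apply (s : X.presheaf.stalk z) :
    (X.presheaf.stalkSpecializes h ≫ X.residue (ρ.base η1) ≫ ρ.residueFieldMap η1).hom s =
      (ρ.residueFieldMap η1).hom ((X.residue (ρ.base η1)).hom ((X.presheaf.stalkSpecializes h).hom s)) := by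
  rfl

include hb in
/-- **The local structure map `g₀ : 𝒪_(X,z) → V¹` of the branch, read upstairs**: local, and
`(V¹ ⊆ κ(η¹)) ∘ g₀ = (𝒪_(X,z) → 𝒪_(X,η) → κ(η) → κ(η¹))`. [this work] -/
theorem exists_toValuationSubring :
    ∃ g₀ : X.presheaf.stalk z →+* V1, IsLocalHom g₀ ∧
      V1.subtype.comp g₀ = (X.presheaf.stalkSpecializes h ≫ X.residue (ρ.base η1) ≫ ρ.residueFieldMap η1).hom := by
  set f := ρ.residueFieldMap η1 with hf
  set V : ValuationSubring (X.residueField (ρ.base η1)) := V1.comap f.hom with hV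
  -- the restriction `V → V¹` of `f`
  let r : V →+* V1 := (f.hom.comp V.subtype).codRestrict V1.toSubring fun v => ValuationSubring.mem_comap.mp v.2
  have hr : IsLocalHom r := by
    refine ⟨fun v hv => ?_⟩
    have hv' : IsUnit (r v : X1.residueField η1) := hv.map V1.subtype
    have hv0 : (v : X.residueField (ρ.base η1)) ≠ 0 := by
      intro h0
      apply hv'.ne_zero
      change f.hom (v : X.residueField (ρ.base η1)) = 0
      rw [h0, map_zero]
    -- `(f v)⁻¹ ∈ V¹`, hence `v⁻¹ ∈ V`
    have hinv1 : (f.hom (v : X.residueField (ρ.base η1)))⁻¹ ∈ V1 := by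
      obtain ⟨u, hu⟩ := hv
      have : ((↑(u⁻¹) : V1) : X1.residueField η1) = (f.hom (v : X.residueField (ρ.base η1)))⁻¹ := by
        have hmul : ((u : V1) : X1.residueField η1) * ((↑(u⁻¹) : V1) : X1.residueField η1) = 1 := by
          rw [← Subring.coe_mul V1.toSubring]
          change (((u * u⁻¹ : V1ˣ) : V1) : X1.residueField η1) = 1
          simp
        rw [hu] at hmul
        exact (eq_inv_of_mul_eq_one_right hmul)
      rw [← this]
      exact (↑(u⁻¹) : V1).2
    have hinv : (v : X.residueField (ρ.base η1))⁻¹ ∈ V := by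
      change _ ∈ V1.comap f.hom
      rw [ValuationSubring.mem_comap, map_inv₀]
      exact hinv1
    exact isUnit_iff_exists_inv.mpr ⟨⟨_, hinv⟩, Subtype.ext (mul_inv_cancel₀ hv0)⟩
  haveI := hr
  haveI := isLocalHom_toBranch z (ρ.base η1) h V hb
  refine ⟨r.comp (toBranch z (ρ.base η1) h V hb), RingHom.isLocalHom_comp _ _, ?_⟩
  ext s
  rfl

/-! ## Existence of the branch upstairs (valuative criterion of properness) -/

include hb in
/-- **(S1a) BRANCH LIFT.**  For `ρ : X¹ ⟶ X` universally closed (e.g. proper), a branch `V = V¹ ∩ κ(η)` of the curve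
`closure {ρ η¹}` at `z` is, upstairs, a branch of `closure {η¹}` at some point `y′` over `z`: there are `y′ ∈ X¹` and
`η¹ ⤳ y′` with `ρ y′ = z` and `IsBranchAt y′ η¹ _ V¹`.  The point `y′` is the CENTRE of `V¹` on `X¹`: the lift
`Spec V¹ → X¹` of the square (`Spec κ(η¹) → X¹`, `Spec V¹ → Spec 𝒪_(X,z) → X`) given by the valuative criterion.
[cite: StacksProject, Tag 01KF] -/
theorem exists_isBranchAt_lift [UniversallyClosed ρ] :
    ∃ (y' : X1) (h1 : η1 ⤳ y'), ρ.base y' = z ∧ IsBranchAt y' η1 h1 V1 := by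
  obtain ⟨g₀, hg₀loc, hg₀⟩ := exists_toValuationSubring ρ η1 h V1 hb
  haveI := hg₀loc
  haveI : IsLocalHom (CommRingCat.ofHom g₀).hom := hg₀loc
  -- the valuative square
  let K : Type := X1.residueField η1
  have hsq : CommSq (X1.fromSpecResidueField η1) (Spec.map (CommRingCat.ofHom (algebraMap V1 K))) ρ
      (Spec.map (CommRingCat.ofHom g₀) ≫ X.fromSpecStalk z) := by
    constructor
    rw [← Scheme.Hom.SpecMap_residueFieldMap_fromSpecResidueField, Scheme.fromSpecResidueField,
      ← Scheme.SpecMap_stalkSpecializes_fromSpecStalk h, ← Spec.map_comp_assoc, ← Spec.map_comp_assoc,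
      ← Spec.map_comp_assoc]
    congr 2
    ext s
    change _ = V1.subtype (g₀ s)
    rw [← RingHom.comp_apply, hg₀]
  let S : ValuativeCommSq ρ :=
    { R := V1, K := K, i₁ := X1.fromSpecResidueField η1,
      i₂ := Spec.map (CommRingCat.ofHom g₀) ≫ X.fromSpecStalk z, commSq := hsq }
  have hE : ValuativeCriterion.Existence ρ := by
    have hq : (ValuativeCriterion.Existence ⊓ @QuasiCompact) ρ :=
      UniversallyClosed.eq_valuativeCriterion ▸ (inferInstance : UniversallyClosed ρ)
    exact hq.1
  haveI : S.commSq.HasLift := hE S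
  let l : Spec (.of V1) ⟶ X1 := S.commSq.lift
  have hl₁ : Spec.map (CommRingCat.ofHom (algebraMap V1 K)) ≫ l = X1.fromSpecResidueField η1 := S.commSq.fac_left
  have hl₂ : l ≫ ρ = Spec.map (CommRingCat.ofHom g₀) ≫ X.fromSpecStalk z := S.commSq.fac_right
  -- the centre `y′` and the local map `g : 𝒪_(X¹,y′) → V¹`
  set y' : X1 := l (closedPoint V1) with hy'
  -- `ρ y′ = z`
  have hρy : ρ.base y' = z := by
    change (l ≫ ρ) (closedPoint V1) = z
    rw [hl₂, Scheme.Hom.comp_apply, Spec_closedPoint, Scheme.fromSpecStalk_closedPoint]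
  -- `η¹ ⤳ y′`
  have h1 : η1 ⤳ y' := by
    have hpt : (Spec.map (CommRingCat.ofHom (algebraMap V1 K)) ≫ l) (closedPoint K) = η1 := by
      rw [hl₁]
      exact Scheme.fromSpecResidueField_apply η1 _
    rw [← hpt, Scheme.Hom.comp_apply]
    refine Specializes.map ?_ l.base.hom.continuous
    exact (PrimeSpectrum.le_iff_specializes _ (closedPoint V1)).mp
      (IsLocalRing.le_maximalIdeal (Spec.map (CommRingCat.ofHom (algebraMap (↥V1) K)) (closedPoint K)).2.ne_top)
  -- the local map at the centre and its compatibility with `κ(η¹)`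
  let g := Scheme.stalkClosedPointTo l
  have hg : g ≫ CommRingCat.ofHom (algebraMap V1 K) = X1.presheaf.stalkSpecializes h1 ≫ X1.residue η1 := by
    apply Spec.map_injective
    rw [← cancel_mono (X1.fromSpecStalk y'), Spec.map_comp, Category.assoc,
      Scheme.Spec_stalkClosedPointTo_fromSpecStalk, hl₁, Spec.map_comp, Category.assoc,
      Scheme.SpecMap_stalkSpecializes_fromSpecStalk]
    rfl
  have hg_apply : ∀ s : X1.presheaf.stalk y', ((g.hom s : V1) : K) =
      (X1.residue η1).hom ((X1.presheaf.stalkSpecializes h1).hom s) := by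
    intro s
    exact congrArg (fun φ => φ.hom s) hg
  refine ⟨y', h1, hρy, ?_, ?_, ?_⟩
  · -- `V¹ ≠ ⊤` since `V ≠ ⊤`
    intro htop
    apply hb.1
    ext x
    simp [ValuationSubring.mem_comap, htop]
  · -- the curve germ at `y′` lies in `V¹`
    rintro x ⟨s, rfl⟩
    change (X1.residue η1).hom ((X1.presheaf.stalkSpecializes h1).hom s) ∈ V1
    rw [← hg_apply]
    exact (g.hom s).2
  · -- domination: a germ element invertible in `V¹` is invertible in the germ
    rintro x ⟨s, rfl⟩ hinv
    change ((X1.residue η1).hom ((X1.presheaf.stalkSpecializes h1).hom s))⁻¹ ∈ curveGerm y' η1 h1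
    by_cases hx0 : (X1.residue η1).hom ((X1.presheaf.stalkSpecializes h1).hom s) = 0
    · rw [hx0, inv_zero]; exact zero_mem _
    · -- `g s` is a unit of `V¹`, hence `s` a unit of `𝒪_(X¹,y′)`
      have hmem : ((X1.residue η1).hom ((X1.presheaf.stalkSpecializes h1).hom s))⁻¹ ∈ V1 := hinv
      have hunit : IsUnit (g.hom s) := by
        refine isUnit_iff_exists_inv.mpr
          ⟨⟨((X1.residue η1).hom ((X1.presheaf.stalkSpecializes h1).hom s))⁻¹, hmem⟩, ?_⟩
        apply Subtype.ext
        change ((g.hom s : V1) : K) * ((X1.residue η1).hom ((X1.presheaf.stalkSpecializes h1).hom s))⁻¹ = 1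
        rw [hg_apply]
        exact mul_inv_cancel₀ hx0
      have hsu : IsUnit s := (isUnit_map_iff g.hom s).mp hunit
      obtain ⟨u, rfl⟩ := hsu
      refine ⟨(↑(u⁻¹) : X1.presheaf.stalk y'), ?_⟩
      change (X1.residue η1).hom ((X1.presheaf.stalkSpecializes h1).hom ↑(u⁻¹)) = _
      rw [← RingHom.comp_apply, ← RingHom.comp_apply, ← CommRingCat.hom_comp]
      exact (map_units_inv ((X1.presheaf.stalkSpecializes h1 ≫ X1.residue η1).hom) u)

/-! ## Uniqueness of the centre (valuative criterion of separatedness) -/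

include hb in
/-- **Uniqueness of the point carrying the branch**: for `ρ` separated, two points `y′, y″` over `z`, both specialisations
of `η¹` at which `V¹` is a branch of `closure {η¹}`, coincide — both give lifts of the same valuative square.
[cite: StacksProject, Tag 01KZ] -/
theorem eq_of_isBranchAt_of_isBranchAt [IsSeparated ρ] {y' y'' : X1} (h1' : η1 ⤳ y') (h1'' : η1 ⤳ y'')
    (hy' : ρ.base y' = z) (hy'' : ρ.base y'' = z) (hb' : IsBranchAt y' η1 h1' V1) (hb'' : IsBranchAt y'' η1 h1'' V1) :
    y' = y'' := by
  obtain ⟨g₀, hg₀loc, hg₀⟩ := exists_toValuationSubring ρ η1 h V1 hb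
  haveI := hg₀loc
  haveI : IsLocalHom (CommRingCat.ofHom g₀).hom := hg₀loc
  let K : Type := X1.residueField η1
  have hsq : CommSq (X1.fromSpecResidueField η1) (Spec.map (CommRingCat.ofHom (algebraMap V1 K))) ρ
      (Spec.map (CommRingCat.ofHom g₀) ≫ X.fromSpecStalk z) := by
    constructor
    rw [← Scheme.Hom.SpecMap_residueFieldMap_fromSpecResidueField, Scheme.fromSpecResidueField,
      ← Scheme.SpecMap_stalkSpecializes_fromSpecStalk h, ← Spec.map_comp_assoc, ← Spec.map_comp_assoc,
      ← Spec.map_comp_assoc]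
    congr 2
    ext s
    change _ = V1.subtype (g₀ s)
    rw [← RingHom.comp_apply, hg₀]
  let S : ValuativeCommSq ρ :=
    { R := V1, K := K, i₁ := X1.fromSpecResidueField η1,
      i₂ := Spec.map (CommRingCat.ofHom g₀) ≫ X.fromSpecStalk z, commSq := hsq }
  -- a branch point gives a lift through it
  have key : ∀ {y : X1} (hy1 : η1 ⤳ y) (hyz : ρ.base y = z) (hby : IsBranchAt y η1 hy1 V1),
      ∃ L : S.commSq.LiftStruct, L.l (closedPoint V1) = y := by
    intro y hy1 hyz hby
    let gy : X1.presheaf.stalk y →+* V1 := toBranch y η1 hy1 V1 hby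
    haveI : IsLocalHom gy := isLocalHom_toBranch y η1 hy1 V1 hby
    haveI : IsLocalHom (CommRingCat.ofHom gy).hom := ‹IsLocalHom gy›
    have hgy : V1.subtype.comp gy = (X1.presheaf.stalkSpecializes hy1 ≫ X1.residue η1).hom := RingHom.ext fun _ => rfl
    refine ⟨⟨Spec.map (CommRingCat.ofHom gy) ≫ X1.fromSpecStalk y, ?_, ?_⟩, ?_⟩
    · -- upper triangle
      change Spec.map (CommRingCat.ofHom (algebraMap V1 K)) ≫ Spec.map (CommRingCat.ofHom gy) ≫ X1.fromSpecStalk y =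
        X1.fromSpecResidueField η1
      rw [← Spec.map_comp_assoc, Scheme.fromSpecResidueField, ← Scheme.SpecMap_stalkSpecializes_fromSpecStalk hy1,
        ← Spec.map_comp_assoc]
      congr 2
    · -- lower triangle: compare through `SpecToEquivOfLocalRing`
      change (Spec.map (CommRingCat.ofHom gy) ≫ X1.fromSpecStalk y) ≫ ρ =
        Spec.map (CommRingCat.ofHom g₀) ≫ X.fromSpecStalk z
      haveI hgl : IsLocalHom (ρ.stalkMap y ≫ CommRingCat.ofHom gy).hom := by
        rw [CommRingCat.hom_comp]
        exact RingHom.isLocalHom_comp _ _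
      have e1 : (Spec.map (CommRingCat.ofHom gy) ≫ X1.fromSpecStalk y) ≫ ρ =
          (SpecToEquivOfLocalRing X (.of V1)).symm ⟨ρ.base y, ρ.stalkMap y ≫ CommRingCat.ofHom gy, hgl⟩ := by
        rw [Category.assoc, ← Scheme.SpecMap_stalkMap_fromSpecStalk, ← Category.assoc, ← Spec.map_comp]
        rfl
      have e2 : Spec.map (CommRingCat.ofHom g₀) ≫ X.fromSpecStalk z =
          (SpecToEquivOfLocalRing X (.of V1)).symm ⟨z, CommRingCat.ofHom g₀, inferInstance⟩ := rfl
      rw [e1, e2]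
      congr 1
      refine SpecToEquivOfLocalRing_eq_iff.mpr ⟨hyz, ?_⟩
      -- equality of ring maps `𝒪_(X,ρ y) → V¹`, checked in `κ(η¹)`
      ext a
      change ((V1.subtype.comp gy) ((ρ.stalkMap y).hom a)) =
        (V1.subtype.comp g₀) ((X.presheaf.stalkSpecializes (Inseparable.of_eq hyz).ge).hom a)
      rw [hgy, hg₀]
      change (ρ.stalkMap y ≫ X1.presheaf.stalkSpecializes hy1 ≫ X1.residue η1).hom a =
        (X.presheaf.stalkSpecializes (Inseparable.of_eq hyz).ge ≫ X.presheaf.stalkSpecializes h ≫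
          X.residue (ρ.base η1) ≫ ρ.residueFieldMap η1).hom a
      rw [TopCat.Presheaf.stalkSpecializes_comp_assoc, Scheme.residue_residueFieldMap,
        ← Scheme.Hom.stalkSpecializes_stalkMap_assoc ρ η1 y hy1]
    · change (Spec.map (CommRingCat.ofHom gy) ≫ X1.fromSpecStalk y) (closedPoint V1) = y
      rw [Scheme.Hom.comp_apply, Spec_closedPoint, Scheme.fromSpecStalk_closedPoint]
  obtain ⟨L', hL'⟩ := key h1' hy' hb'
  obtain ⟨L'', hL''⟩ := key h1'' hy'' hb''
  haveI := IsSeparated.valuativeCriterion ρ S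
  have hLL : L' = L'' := Subsingleton.elim _ _
  rw [← hL', ← hL'', hLL]

end BranchLift

end Summit.ResolutionOfSingularities.ResolutionOfSingularities.Theorems.NoZeno.ExcCount

end
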